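import Summits.BirchSwinnertonDyer.Rank1Residual.X12.JZeroThreeTorsionCriterion
import Literature.NumberTheory.EllipticCurves.MordellCurveSqrtThreeEndomorphism
import Literature.NumberTheory.EllipticCurves.HuShuYin2019.SylvesterThreePart
import Literature.NumberTheory.EllipticCurves.IsogenyIdProofs
import HarnessLib

/-!
# Route PrintCFram, regime T `LocalThreeTorsionBSDThree` (stmt-BirchSwinnertonDyer-20699): its RATIONAL
# sub-regime T_cube is exactly the cube-sum world `x³ + y³ = n` (cell `bsd-print-cfram`, seat p4)

HONEST FRAMING (cell `bsd-print-cfram`, run/shared/lean/pub/bsd-print-cfram/, D-0131 (2) print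
tier; verbatim in every file of the seat): the cell works the partition leaf
`CornerF ∧ p ramified in the CM field K` (LADDER-BSD row K7r = B13; W-ALL row 12r) in PARTITION
currency — a leaf or a cell counts only when its theorem is in the kernel BY NAME. Nothing is closed
here. STRUCTURE for regime T of the crux C1 (route rev 6): by this seat's criterion
(`X12.JZeroThree.noThreeTorsion_mordellCurve_pair_iff`, p546152) a `j = 0` class is in T iff `k` or
`−3k` is a square in `ℚ₃` for its Mordell coefficient `k`; the census of all 919 classes `N < 5·10⁵`
(kit j284048) splits T = T_cube (178 classes: `k` or `−3k` a RATIONAL square) ⊔ T_split (296: `3`-adic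
squares only). THIS FILE pins T_cube BY NAME: (i) over `ℚ`, «`E_k` or `E_{−27k}` has a rational
point of order `3`» ⟺ «`k ∈ ℚ²` or `−3k ∈ ℚ²`» (`exists_rational_three_torsion_pair_iff`); (ii) every
cube-sum curve `x³ + y³ = n` (`HuShuYin2019.cubeSumCurve n = y² = x³ − 432n²`) is there
(`−3·(−432n²) = (36n)²`; its partner `E_{11664n²}` carries `(0, 108n)` of order `3`); (iii) conversely
every `E_k` with `k ∈ ℚ²` or `−3k ∈ ℚ²` is `ℚ`-ISOGENOUS to a cube-sum curve
(`exists_isIsogenous_cubeSumCurve`: `−3k = c²` ⟹ `E_k = E_{−432(c/36)²}` literally; `k = c²` ⟹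
`E_{c²} ~ E_{−27c²} = E_{−432(c/4)²}` by Vélu's `3`-isogeny, tree `SqrtThree.isVeluThreePair_sq`). So
T_cube = the classes of the cube-sum curves = the home of EVERY printed @3 rank-one family except
Kriz–Li's sextic twists (HSY19 Thm 1.4, CST14/17, Kezuka–Li 2020 Cor 1.2, Shu–Yin 2022 Thm 1.2), and
T_split (no rational `3`-torsion anywhere in the class, `3`-adic only; 27 window classes, 296 in
Cremona's range) has NO print at all (lit DOSSIER §25). Theorems only; no named fact. beyond-print: NO.

References: `X12/JZeroThreeTorsionCriterion.lean`; HOME p4/g2/REGIME-CENSUS-919.md; [cite: SilvermanAEC2009, Exercise 3.7 and X.5];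
[cite: HuShuYin2019, §1 (the curves E_n : y² = x³ − 432n²)].
-/

set_option linter.dupNamespace false
set_option autoImplicit false

noncomputable section

open scoped Classical

open WeierstrassCurve Literature.NumberTheory.EllipticCurves
  Summit.BirchSwinnertonDyer.Rank1Residual.X12

namespace Summit.BirchSwinnertonDyer.BirchSwinnertonDyer.Theorems.PrintCFram

/-- The cube-sum curve `x³ + y³ = n` in Mordell form: `cubeSumCurve n = (y² = x³ − 432n²)` (by
definition). [cite: HuShuYin2019, §1] -/
theorem cubeSumCurve_eq_mordellCurve (n : ℚ) :
    HuShuYin2019.cubeSumCurve n = mordellCurve (-432 * n ^ 2) := rfl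

/-- **T_cube membership over `ℚ`.** For `k ≠ 0`: `E_k : y² = x³ + k` or its `3`-isogenous partner
`E_{−27k}` has a RATIONAL point of order `3` iff `k` or `−3k` is a rational square (the criterion of
p546152 read over the field `ℚ`). [cite: SilvermanAEC2009, Exercise 3.7] -/
theorem exists_rational_three_torsion_pair_iff {k : ℚ} (hk : k ≠ 0) :
    ((∃ P : (mordellCurve k).toAffine.Point, P ≠ 0 ∧ (3 : ℕ) • P = 0) ∨
      (∃ P : (mordellCurve (-27 * k)).toAffine.Point, P ≠ 0 ∧ (3 : ℕ) • P = 0)) ↔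
      (IsSquare k ∨ IsSquare (-3 * k)) := by
  -- the criterion over the field `ℚ` (stated there with the classical `DecidableEq`; `convert`
  -- bridges the instance to `ℚ`'s own)
  have h : ((∀ P : (mordellCurve k).toAffine.Point, (3 : ℕ) • P = 0 → P = 0) ∧
      (∀ P : (mordellCurve (-27 * k)).toAffine.Point, (3 : ℕ) • P = 0 → P = 0)) ↔
      (¬ IsSquare k ∧ ¬ IsSquare (-3 * k)) := by
    convert JZeroThree.noThreeTorsion_mordellCurve_pair_iff (F := ℚ) hk
  have n1 := JZeroThree.forall_three_nsmul_iff_not_exists (A := (mordellCurve k).toAffine.Point)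
  have n2 := JZeroThree.forall_three_nsmul_iff_not_exists
    (A := (mordellCurve (-27 * k)).toAffine.Point)
  rw [n1, n2] at h
  constructor
  · intro hAB
    by_contra hCD
    obtain ⟨hA, hB⟩ := h.mpr (not_or.mp hCD)
    exact hAB.elim hA hB
  · intro hCD
    by_contra hAB
    obtain ⟨hC, hD⟩ := h.mp (not_or.mp hAB)
    exact hCD.elim hC hD

/-- For a cube-sum curve `−3k` IS a rational square: `−3·(−432n²) = (36n)²`. [folklore] -/
theorem isSquare_neg_three_mul_cubeSumCoeff (n : ℚ) : IsSquare (-3 * (-432 * n ^ 2)) :=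
  ⟨36 * n, by ring⟩

/-- **Every cube-sum curve is in T_cube**: the `3`-isogenous partner `E_{−27·(−432n²)} = E_{11664n²}`
of `x³ + y³ = n` (`n ≠ 0`) carries the rational point `(0, 108n)` of order `3`.
[cite: SilvermanAEC2009, Exercise 3.7] -/
theorem exists_rational_three_torsion_cubeSum_partner {n : ℚ} (hn : n ≠ 0) :
    ∃ P : (mordellCurve (-27 * (-432 * n ^ 2))).toAffine.Point, P ≠ 0 ∧ (3 : ℕ) • P = 0 := by
  have hD : (-27 * (-432 * n ^ 2) : ℚ) ≠ 0 := by positivity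
  obtain ⟨P, hP0, hP3⟩ :=
    (JZeroThree.exists_three_torsion_mordellCurve_iff hD).mpr (Or.inl ⟨108 * n, by ring⟩)
  exact ⟨P, hP0, by convert hP3⟩

/-- **T_cube = the cube-sum classes (converse).** If `k ≠ 0` and `k` or `−3k` is a rational square,
then `E_k` is `ℚ`-isogenous to a cube-sum curve `x³ + y³ = n`, `n ≠ 0`: for `−3k = c²`,
`E_k = E_{−432(c/36)²}` on the nose; for `k = c²`, Vélu's `3`-isogeny `E_{c²} → E_{−27c²}` (tree
`SqrtThree.isVeluThreePair_sq`) lands on `E_{−432(c/4)²}`. [cite: SilvermanAEC2009, III.4 Remark 4.13.3 (Vélu)]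
[cite: HuShuYin2019, §1] -/
theorem exists_isIsogenous_cubeSumCurve {k : ℚ} (hk : k ≠ 0) (h : IsSquare k ∨ IsSquare (-3 * k)) :
    ∃ n : ℚ, n ≠ 0 ∧ IsIsogenous (mordellCurve k) (HuShuYin2019.cubeSumCurve n) := by
  rcases h with ⟨c, hc⟩ | ⟨c, hc⟩
  · have hc0 : c ≠ 0 := by rintro rfl; exact hk (by rw [hc]; ring)
    refine ⟨c / 4, div_ne_zero hc0 (by norm_num), ?_⟩
    have hV := (SqrtThree.isVeluThreePair_sq (F := ℚ) hc0).isIsogenous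
    have e1 : mordellCurve k = mordellCurve (c ^ 2) := by rw [hc, sq]
    have e2 : HuShuYin2019.cubeSumCurve (c / 4) = mordellCurve (-27 * c ^ 2) := by
      rw [cubeSumCurve_eq_mordellCurve]; congr 1; ring
    rw [e1, e2]; exact hV
  · have hc0 : c ≠ 0 := by rintro rfl; exact hk (by linear_combination -hc / 3)
    refine ⟨c / 36, div_ne_zero hc0 (by norm_num), ?_⟩
    have e : mordellCurve k = HuShuYin2019.cubeSumCurve (c / 36) := by
      rw [cubeSumCurve_eq_mordellCurve]; congr 1; linear_combination -hc / 3
    rw [e]; exact WeierstrassCurve.isIsogenous_self _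

/-- **T_cube fails the `ℚ₃`-criterion** (a rational square is a `3`-adic square): if `k` or `−3k` is
a rational square then `k` or `−3k` is a square in `ℚ₃`, so by `noThreeTorsion_mordellCurve_pair_iff`
over `ℚ₃` the pair `(E_k, E_{−27k})` has `ℚ₃`-rational `3`-torsion — T_cube ⊆ T. [folklore] -/
theorem isSquare_padic_of_isSquare_rat {k : ℚ} (h : IsSquare k ∨ IsSquare (-3 * k)) :
    IsSquare ((k : ℚ_[3])) ∨ IsSquare ((-3 * k : ℚ) : ℚ_[3]) := by
  rcases h with ⟨c, hc⟩ | ⟨c, hc⟩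
  · exact Or.inl ⟨(c : ℚ_[3]), by rw [hc]; push_cast; ring⟩
  · exact Or.inr ⟨(c : ℚ_[3]), by rw [hc]; push_cast; ring⟩

end Summit.BirchSwinnertonDyer.BirchSwinnertonDyer.Theorems.PrintCFram

end
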